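import Summits.NavierStokesRegularity.FluidComputer.HeadStartQuiet

/-!
# Tao's delay gate from a CLOCK HEAD-START, part 3: the sharp sub-solution for the trigger

Companion file of `HeadStartTransition.lean`, `HeadStartQuiet.lean` (cell `pub-fluidc`, blueprint seat bp1;
ONE text split by the 400-line rule; namespace `Summit.NavierStokesRegularity.FluidComputer.HeadStart`).
HONEST FRAMING (verbatim): low prior, high value-of-information experiment on Tao's machine paradigm; NOT a
claim that NS blows up. Everything here concerns the five-mode truncation (5.5) of [Tao2016AveragedNS,
§5.5] in the retuned form `delayCircuitWith K M ε` with the diagonal damping `-E(t) * X`, `0 ≤ Eᵢ(t) ≤ η`,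
on `[0,2]`, started in the signed head-start class `HS±(ε)` of part 1 (explicit hypothesis `h0`;
head-start `h := b₀/ε ∈ [-1/5, 2/5]`); nothing is proved about the Navier–Stokes equations.

* `c_lower_sharp` — the sub-solution `c(t) ≥ (ε²/(12K¹⁰)) exp((1-θ)Mt²/2 + Mh·t - 2η - M)` on
  `[1/(2(K⁵+M)), τ]` (`θ = 17K⁻²⁰ + 9η`, `η ≤ 1/10`; `τ` a time with `c ≤ K⁻¹⁰ε²` on `[0,τ]`). THE ONE
  NEW STEP of the text: with a pre-load the trigger's sweep rate `ε⁻¹Mb - E₂ ≥ Mh + (1-θ)Mt - η` is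
  already `Mh` at `t = 0`, so the printed first stage on `[0, K⁻⁵]` (integrating factor `≥ 1/2` because
  `MK⁻¹⁰ ≤ 1`, [Tao2016AveragedNS, p. 29]; `DampedTransitionWindow.lean`) is replaced by the stage
  `[0, 1/(2(K⁵+M))]`, on which the factor is `≥ 1 - (1/8 + h₊/2) ≥ 2/3`; the price is the constant
  `4K⁵ ↦ 6(K⁵+M) ≤ 12K¹⁰`, harmless against the Gaussian `e^{M(t²/2 + ht)}`. For `h < 0` the bound holds
  as stated but is not sharp (no square completion: the true clock is `M(t - |h|)²/2`); part 4 pays `h²`.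

[cite: Tao2016AveragedNS, §5.5 Thm 5.3, proof of (tcable) pp. 28–30]
-/

noncomputable section

namespace Summit.NavierStokesRegularity.FluidComputer

open Real Set Filter Topology
open Literature.Analysis.FluidPDE.Tao2016AveragedNS
open Literature.Analysis.FluidPDE.Tao2016AveragedNS.Thm53 (antitoneOn_intFactor monotoneOn_intFactor
  antitoneOn_sub_of_deriv_le monotoneOn_sub_of_le_deriv abs_sub_le_of_abs_deriv_le)
open Literature.Analysis.FluidPDE.Tao2016AveragedNS.Thm53With (log_facts)
open DampedTransition (hasDerivAt_a hasDerivAt_b hasDerivAt_c hasDerivAt_d hasDerivAt_e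
  exists_hitTime_on continuousOn_traj)

namespace HeadStart

section SubSolution

variable {K M ε η τ : ℝ} {E X : ℝ → Fin 5 → ℝ}

/-- Sharp sub-solution for `c` on `[1/(2(K⁵+M)), τ]` from the class, damping `η ≤ 1/10`:
`c(t) ≥ (ε²/(12K¹⁰)) exp((1-θ)Mt²/2 + ε⁻¹Mb₀·t - 2η - M)`, `θ = 17K⁻²⁰ + 9η` (integrating factor
`exp(-((1-θ)Mt²/2 + (ε⁻¹Mb₀ - η)t))`: `a² ≥ 1/2`, `ε⁻¹Mb ≥ ε⁻¹Mb₀ + (1-θ)Mt`, `-E₂ ≥ -η`; first on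
`[0, 1/(2(K⁵+M))]`, where the factor is `≥ 2/3` because `M ≤ (K⁵+M)²` and `ε⁻¹Mb₀ ≤ 2M/5` (a negative
pre-load only helps here; the bound is then not sharp — the true clock is `M(t-|h|)²/2` — but it suffices), then on
`[1/(2(K⁵+M)), τ]`; finally `6(K⁵+M) ≤ 12K¹⁰`). [cite: Tao2016AveragedNS, §5.5 proof of (tcable)] -/
theorem c_lower_sharp
    (hX : ∀ t ∈ Icc (0:ℝ) 2, HasDerivAt X (delayCircuitWith K M ε (X t) - E t * X t) t)
    (hE : ∀ t ∈ Icc (0:ℝ) 2, ∀ i, 0 ≤ E t i ∧ E t i ≤ η)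
    (h0 : X 0 0 ^ 2 + X 0 1 ^ 2 = 1 ∧ 0 ≤ X 0 0 ∧ -(1 / 5 * ε) ≤ X 0 1 ∧ X 0 1 ≤ 2 / 5 * ε ∧ X 0 2 = 0 ∧ X 0 3 = 0 ∧ X 0 4 = 0)
    (hε : 0 < ε) (hε1 : ε ≤ 1) (hM0 : 0 < M) (hMK : M ≤ K ^ 10) (hK : 2 ≤ K) (hη : η ≤ 1 / 10)
    (hτ2 : τ ≤ 2) (hτ5 : 1 / (2 * (K ^ 5 + M)) ≤ τ)
    (hεK : ε ^ 2 ≤ 1 / (12 * K ^ 20))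
    (hcτ : ∀ t, 0 ≤ t → t ≤ τ → X t 2 ≤ ε ^ 2 / K ^ 10)
    {t : ℝ} (ht : t ∈ Icc (1 / (2 * (K ^ 5 + M))) τ) :
    ε ^ 2 / (12 * K ^ 10) *
      exp ((1 - (17 / K ^ 20 + 9 * η)) * M * t ^ 2 / 2 + ε⁻¹ * M * X 0 1 * t - 2 * η - M) ≤ X t 2 := by
  have hK0 : 0 < K := by linarith
  have hK1 : 1 ≤ K := by linarith
  have hη0 : 0 ≤ η := (hE 0 ⟨le_rfl, zero_le_two⟩ 0).1.trans (hE 0 ⟨le_rfl, zero_le_two⟩ 0).2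
  have hK20 : (2 : ℝ) ^ 20 ≤ K ^ 20 := pow_le_pow_left₀ (by norm_num) hK 20
  set θ : ℝ := 17 / K ^ 20 + 9 * η with hθ
  have hθ0 : 0 ≤ θ := by positivity
  have hθ1 : θ ≤ 1 := by
    have h17 : 17 / K ^ 20 ≤ 1 / 10 := by
      rw [div_le_div_iff₀ (by positivity) (by norm_num)]; norm_num at hK20 ⊢; linarith
    simp only [hθ]; linarith
  set k : ℝ := (1 - θ) * M with hk
  have hk0 : 0 ≤ k := mul_nonneg (by linarith) hM0.le
  have hkM : k ≤ M := by
    have : (1 - θ) * M ≤ 1 * M := mul_le_mul_of_nonneg_right (by linarith) hM0.le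
    simpa [hk] using this
  -- the pre-load's sweep rate `ν₀ = ε⁻¹ M b₀ ∈ [-M/5, 2M/5]` (only the upper bound is used)
  set ν₀ : ℝ := ε⁻¹ * M * X 0 1 with hν₀
  have hν₀M : ν₀ ≤ 2 / 5 * M := by
    have := mul_le_mul_of_nonneg_left h0.2.2.2.1 (by have := hM0.le; positivity : (0:ℝ) ≤ ε⁻¹ * M)
    calc ν₀ = ε⁻¹ * M * X 0 1 := hν₀
      _ ≤ ε⁻¹ * M * (2 / 5 * ε) := this
      _ = 2 / 5 * M := by field_simp
  set μ : ℝ := ε ^ 2 * exp (-M) with hμ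
  have hμ0 : 0 ≤ μ := by positivity
  set R : ℝ := K ^ 5 + M with hR
  have hR0 : 0 < R := by positivity
  set s₀ : ℝ := 1 / (2 * R) with hs₀
  have hs₀0 : 0 < s₀ := by positivity
  -- `M s₀² ≤ 1/4` (from `M ≤ K¹⁰ ≤ R²`) and `(2M/5) s₀ ≤ 1/5`
  have hMR : M ≤ R * R := by
    have h5 : K ^ 5 ≤ R := by simp only [hR]; linarith
    calc M ≤ K ^ 10 := hMK
      _ = K ^ 5 * K ^ 5 := by ring
      _ ≤ R * R := mul_le_mul h5 h5 (by positivity) hR0.le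
  have hks₀ : k * (s₀ * s₀) ≤ 1 / 4 := by
    calc k * (s₀ * s₀) ≤ M * (s₀ * s₀) := mul_le_mul_of_nonneg_right hkM (mul_self_nonneg _)
      _ ≤ R * R * (s₀ * s₀) := mul_le_mul_of_nonneg_right hMR (mul_self_nonneg _)
      _ = 1 / 4 := by simp only [hs₀]; field_simp; ring
  have hMs₀ : M * s₀ ≤ 1 / 2 := by
    have hMR' : M ≤ R := by simp only [hR]; have := pow_pos hK0 5; linarith
    simp only [hs₀]
    rw [mul_one_div, div_le_iff₀ (by positivity)]
    linarith
  have hνs₀ : 2 / 5 * M * s₀ ≤ 1 / 5 := by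
    calc 2 / 5 * M * s₀ = 2 / 5 * (M * s₀) := by ring
      _ ≤ 2 / 5 * (1 / 2) := mul_le_mul_of_nonneg_left hMs₀ (by norm_num)
      _ = 1 / 5 := by norm_num
  -- integrating factor `G(s) = k s²/2 + (ν₀ - η) s`
  have hG : ∀ s, HasDerivAt (fun r : ℝ => k / 2 * (r * r) + (ν₀ - η) * r) (k * s + (ν₀ - η)) s := by
    intro s
    have := (((hasDerivAt_id s).mul (hasDerivAt_id s)).const_mul (k / 2)).add
      ((hasDerivAt_id s).const_mul (ν₀ - η))
    exact this.congr_deriv (by simp; ring)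
  -- the bracket `(c' - (ks + ν₀ - η)c) e^{-G} ≥ (μ/2) e^{-G}` on `[0,τ]`
  have hbr : ∀ s ∈ Icc 0 τ, μ / 2 * exp (-(k / 2 * (s * s) + (ν₀ - η) * s)) ≤
      (ε ^ 2 * exp (-M) * X s 0 ^ 2 + ε⁻¹ * M * X s 1 * X s 2 - E s 2 * X s 2
        - (k * s + (ν₀ - η)) * X s 2) * exp (-(k / 2 * (s * s) + (ν₀ - η) * s)) := by
    intro s hs
    have hs2 : s ∈ Icc (0 : ℝ) 2 := ⟨hs.1, hs.2.trans hτ2⟩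
    have hc0 : 0 ≤ X s 2 := c_nonneg hX hE h0 hε hε1 hM0.le hs2
    have ha1 : |X s 0 - 1| ≤ 8 / K ^ 20 + 2 * η :=
      a_window hX hE h0 hε hε1 hM0.le hK0 hτ2 hεK hcτ hs
    have hb : |X s 1 - (X 0 1 + ε * s)| ≤ (17 / K ^ 20 + 9 * η) * ε * s :=
      b_window hX hE h0 hε hε1 hM0 hMK hK1 hτ2 hεK hcτ hs
    -- `a² ≥ 1/2`
    have h8 : 8 / K ^ 20 ≤ 1 / 40 := by
      rw [div_le_div_iff₀ (by positivity) (by norm_num)]; norm_num at hK20 ⊢; linarith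
    have ha_lo : 3 / 4 ≤ X s 0 := by have := (abs_le.1 ha1).1; linarith
    have ha2 : 1 / 2 ≤ X s 0 ^ 2 := by nlinarith
    -- `ν b ≥ k s + ν₀`
    have hνb : k * s + ν₀ ≤ ε⁻¹ * M * X s 1 := by
      have hb' : X 0 1 + ε * s - θ * ε * s ≤ X s 1 := by
        have := (abs_le.1 hb).1; simp only [hθ]; linarith
      calc k * s + ν₀ = ε⁻¹ * M * (X 0 1 + ε * s - θ * ε * s) := by
            simp only [hk, hν₀]; field_simp; ring
        _ ≤ ε⁻¹ * M * X s 1 :=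
            mul_le_mul_of_nonneg_left hb' (by have := hM0.le; positivity)
    have h1 : μ / 2 ≤ ε ^ 2 * exp (-M) * X s 0 ^ 2 := by
      have : ε ^ 2 * exp (-M) * (1 / 2) ≤ ε ^ 2 * exp (-M) * X s 0 ^ 2 :=
        mul_le_mul_of_nonneg_left ha2 (by positivity)
      simp only [hμ] at this ⊢; linarith
    have h2 : (k * s + ν₀) * X s 2 ≤ ε⁻¹ * M * X s 1 * X s 2 := mul_le_mul_of_nonneg_right hνb hc0
    have h3 : E s 2 * X s 2 ≤ η * X s 2 := mul_le_mul_of_nonneg_right (hE s hs2 2).2 hc0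
    have hbr' : μ / 2 ≤ ε ^ 2 * exp (-M) * X s 0 ^ 2 + ε⁻¹ * M * X s 1 * X s 2 - E s 2 * X s 2
        - (k * s + (ν₀ - η)) * X s 2 := by
      have e : (k * s + (ν₀ - η)) * X s 2 = (k * s + ν₀) * X s 2 - η * X s 2 := by ring
      linarith
    exact mul_le_mul_of_nonneg_right hbr' (exp_pos _).le
  -- Stage A: on `[0, s₀]`, `e^{-G} ≥ 2/3`, so `c e^{-G} - (μ/3) s` is monotone
  have hs₀τ : s₀ ≤ τ := hτ5
  have hmonoA := monotoneOn_intFactor (s := Icc 0 s₀) (g := fun s => k * s + (ν₀ - η))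
    (G := fun r => k / 2 * (r * r) + (ν₀ - η) * r) (φ := fun _ => μ / 3) (Φ := fun s => μ / 3 * s)
    (convex_Icc 0 s₀) (fun s hs => hasDerivAt_c (hX s ⟨hs.1, hs.2.trans (hs₀τ.trans hτ2)⟩))
    (fun s _ => hG s)
    (fun s _ => ((hasDerivAt_id s).const_mul (μ / 3)).congr_deriv (by simp))
    (fun s hs => by
      have hsτ : s ∈ Icc 0 τ := ⟨hs.1, hs.2.trans hs₀τ⟩
      have hexp : 2 / 3 ≤ exp (-(k / 2 * (s * s) + (ν₀ - η) * s)) := by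
        have hss : k * (s * s) ≤ 1 / 4 := by
          calc k * (s * s) ≤ k * (s₀ * s₀) :=
                mul_le_mul_of_nonneg_left (mul_self_le_mul_self hs.1 hs.2) hk0
            _ ≤ 1 / 4 := hks₀
        have hνs : ν₀ * s ≤ 1 / 5 :=
          calc ν₀ * s ≤ 2 / 5 * M * s := mul_le_mul_of_nonneg_right hν₀M hs.1
            _ ≤ 2 / 5 * M * s₀ := mul_le_mul_of_nonneg_left hs.2 (by positivity)
            _ ≤ 1 / 5 := hνs₀
        have harg : -(1 / 3 : ℝ) ≤ -(k / 2 * (s * s) + (ν₀ - η) * s) := by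
          have hηs : 0 ≤ η * s := mul_nonneg hη0 hs.1
          have e : -(k / 2 * (s * s) + (ν₀ - η) * s) = -(k * (s * s)) / 2 - ν₀ * s + η * s := by ring
          rw [e]; linarith
        calc (2 / 3 : ℝ) ≤ -(1 / 3 : ℝ) + 1 := by norm_num
          _ ≤ exp (-(1 / 3 : ℝ)) := Real.add_one_le_exp _
          _ ≤ exp (-(k / 2 * (s * s) + (ν₀ - η) * s)) := exp_le_exp.2 harg
      calc μ / 3 = μ / 2 * (2 / 3) := by ring
        _ ≤ μ / 2 * exp (-(k / 2 * (s * s) + (ν₀ - η) * s)) :=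
            mul_le_mul_of_nonneg_left hexp (by positivity)
        _ ≤ _ := hbr s hsτ)
  have hA := hmonoA (⟨le_rfl, hs₀0.le⟩ : (0 : ℝ) ∈ Icc 0 s₀) ⟨hs₀0.le, le_rfl⟩ hs₀0.le
  simp only [h0.2.2.2.2.1, zero_mul, mul_zero, add_zero, sub_zero] at hA
  -- Stage B: on `[s₀, τ]`, `c e^{-G}` is monotone
  have hmonoB := monotoneOn_intFactor (s := Icc s₀ τ) (g := fun s => k * s + (ν₀ - η))
    (G := fun r => k / 2 * (r * r) + (ν₀ - η) * r) (φ := fun _ => 0) (Φ := fun _ => 0)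
    (convex_Icc s₀ τ) (fun s hs => hasDerivAt_c (hX s ⟨hs₀0.le.trans hs.1, hs.2.trans hτ2⟩))
    (fun s _ => hG s)
    (fun s _ => hasDerivAt_const s (0 : ℝ))
    (fun s hs => by
      have hsτ : s ∈ Icc 0 τ := ⟨hs₀0.le.trans hs.1, hs.2⟩
      exact le_trans (by positivity) (hbr s hsτ))
  have hB := hmonoB (⟨le_rfl, hs₀τ⟩ : s₀ ∈ Icc s₀ τ) ht ht.1
  simp only [sub_zero] at hB
  -- combine: `c t e^{-G t} ≥ (μ/3) s₀`
  have hct : μ / 3 * s₀ ≤ X t 2 * exp (-(k / 2 * (t * t) + (ν₀ - η) * t)) := by linarith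
  have ht0 : 0 ≤ t := hs₀0.le.trans ht.1
  have ht2 : t ≤ 2 := ht.2.trans hτ2
  have hE' : X t 2 = X t 2 * exp (-(k / 2 * (t * t) + (ν₀ - η) * t))
      * exp (k / 2 * (t * t) + (ν₀ - η) * t) := by
    rw [mul_assoc, ← exp_add, neg_add_cancel, exp_zero, mul_one]
  -- `(μ/3) s₀ = ε² e^{-M}/(6R) ≥ ε² e^{-M}/(12 K¹⁰)`
  have hR2 : R ≤ 2 * K ^ 10 := by
    have h5 : K ^ 5 ≤ K ^ 10 := pow_le_pow_right₀ hK1 (by norm_num)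
    simp only [hR]; linarith
  have hpref : ε ^ 2 / (12 * K ^ 10) * exp (-M) ≤ μ / 3 * s₀ := by
    have e : μ / 3 * s₀ = ε ^ 2 * exp (-M) / (6 * R) := by simp only [hμ, hs₀]; field_simp; ring
    rw [e, div_mul_eq_mul_div, div_le_div_iff₀ (by positivity) (by positivity)]
    have h6 : 6 * R ≤ 12 * K ^ 10 := by linarith
    exact mul_le_mul_of_nonneg_left h6 (by positivity)
  rw [hE']
  calc ε ^ 2 / (12 * K ^ 10) * exp ((1 - (17 / K ^ 20 + 9 * η)) * M * t ^ 2 / 2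
        + ε⁻¹ * M * X 0 1 * t - 2 * η - M)
      = ε ^ 2 / (12 * K ^ 10) * exp (-M) * exp (k / 2 * (t * t) + ν₀ * t - 2 * η) := by
        simp only [hk, hθ, hν₀]
        rw [show (1 - (17 / K ^ 20 + 9 * η)) * M * t ^ 2 / 2 + ε⁻¹ * M * X 0 1 * t - 2 * η - M
            = -M + ((1 - (17 / K ^ 20 + 9 * η)) * M / 2 * (t * t) + ε⁻¹ * M * X 0 1 * t - 2 * η)
            by ring, exp_add (-M)]
        ring
    _ ≤ μ / 3 * s₀ * exp (k / 2 * (t * t) + ν₀ * t - 2 * η) :=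
        mul_le_mul_of_nonneg_right hpref (exp_pos _).le
    _ ≤ μ / 3 * s₀ * exp (k / 2 * (t * t) + (ν₀ - η) * t) := by
        have hηt : η * t ≤ 2 * η := by
          have := mul_le_mul_of_nonneg_left ht2 hη0; linarith
        refine mul_le_mul_of_nonneg_left (exp_le_exp.2 ?_) (by positivity)
        have e : (ν₀ - η) * t = ν₀ * t - η * t := by ring
        rw [e]; linarith
    _ ≤ X t 2 * exp (-(k / 2 * (t * t) + (ν₀ - η) * t)) * exp (k / 2 * (t * t) + (ν₀ - η) * t) :=
        mul_le_mul_of_nonneg_right hct (exp_pos _).le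

end SubSolution

end HeadStart

end Summit.NavierStokesRegularity.FluidComputer
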